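import Summits.ABC.IUTFork.Cor312LicenceShallowMultiSlot
import HarnessLib

/-!
# [IUTchIII] Cor. 3.12 — the (xi-f) inclusion at the sharp real settings from (Ind2)-movers at BALL-SHAPED unit-log places
# (`log_p(𝒪_x^×) = 𝔪_x`): the inhabited leg of the tame dichotomy, with tameness replaced by the ball hypothesis

PROOF-ONLY support piece (D-0012; 0 definitions, 0 `Prop` facts) of the abc-iut cell (branch D seat abc-iut-D1-prv, gen 4; D-0079
R-W «WINDOW Θ-SIDE INEQUALITY», row «W:T1½ TAME-BOUNDARY lane=U», plan g9 RULING C-R29 (2)). TAKES NO SIDE on [IUTchIII] Cor. 3.12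
(S. Mochizuki, *Inter-universal Teichmüller theory III*, kurims manuscript, Cor. 3.12 p. 173 l. 41 – p. 174 l. 19; Step (xi-f) p. 184
l. 26–29; Thm. 3.11 (i) (Ind2) p. 154) or on any author: every statement is about OUR typed objects (abc-iut-c312-5's `logShellsDH`,
abc-iut-c312-3's sharp idele boxes, the assembled setting `settingDHVolSharp`) and Dupuy–Hilado's typed (Ind2) `Real.ismDH`.

THE POINT. abc-iut-w5-d236's one-factor movers (`Cor312LicenceShallowRealTame` §1) and abc-iut-w5-d180's multi-slot donation
(`Cor312LicenceShallowMultiSlot` §3–§4) use tameness (`p > 2`, `e_x ≤ p − 2`) at EXACTLY ONE point: abc-iut-w5-d180's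
`logUnits_eq_closedBall_of_tame`, **`log_p(𝒪_x^×) = 𝔪_x = {‖y‖ ≤ ‖ϖ_x‖}`**. This file re-runs the chain with that equality as
the HYPOTHESIS (a «ball place»), so that it applies verbatim on D-0079 R-W's boundary stratum U1½ (`e_x = p − 1`, `ζ_p ∉ K_x`,
where the equality still holds: abc-iut-w6-d060 `TorsionFree.logUnits_eq_closedBall_of_le_pred`), and at any other place where a
seat certifies the ball:

* §1 `exists_mem_ismDH_apply_eq_of_ball` / `exists_mem_ismDH_norm_apply_eq_of_ball` / `exists_mover_of_ball` — (Ind2) is TRANSITIVE on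
  each `p`-level `{‖p‖^{k+1}‖ϖ‖ < ‖y‖ ≤ ‖p‖^k‖ϖ‖}` of `𝔪_x` (abc-iut-w5-d180 `exists_mem_ismDH_apply_eq_of_primitive`, Weil II §2 Th. 1);
* §2 `exists_mem_ismDH_norm_one_eq_of_ball` (a non-last slot DONATES `‖p‖⁻¹·‖ϖ_x‖ = ‖ϖ_x‖^{1−e_x}`), the fibre-point forms
  `exists_mem_ismDH_norm_one_ge_of_ball` / `exists_mem_ismDH_norm_labelIdele_ge_of_ball`;
* §3 **`qRegion_subset_thetaHull_settingDHVolSharp_of_ball_slots`** (abc-iut-w5-d180's `…_of_tame_slots` with «tame» ↦ «ball») and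
  **`qRegion_subset_thetaHull_settingDHVolSharp_of_ball_orders`**: at a prime `p` whose fibre consists of ball places with ONE
  ramification index `e`, and integer exponents `‖t_{Θ,j,w}‖ = ‖ϖ_w‖^{m_Θ}`, `‖t_{q,w}‖ = ‖ϖ_w‖^{m_q}`, `m_Θ ≥ 1` with
  **`e·((m_Θ−1) div e) + 1 − j·(e−1) ≤ m_q`** at every `w | p`, the q-pilot region at `(j, p)` lies in `ⁿ˚𝒰_{j,p}`.
  No hypothesis `p > 2` is needed on this (inhabited) side.

HONEST SCOPE: OUR sharp containers (Θ-regions constant in `m`), Dupuy–Hilado's typed (Ind1)/(Ind2) acting independently on every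
(capsule slot, place) as abc-iut-c312-1 typed Thm. 3.11 (i); the per-packet hull reading is a STRONGER-THAN-PRINT form (referee lanes
A1/A2); nothing about the printed GLOBAL inequality; nothing asserts or refutes [IUTchIII] Cor. 3.12; typed ≠ proved; instantiated ≠
endorsed. [cite: DupuyHilado2025, §3.9, §4.9] [cite: WeilBNT1967, Ch. II §2, Th. 1] [cite: NeukirchANT1999, Ch. II Prop. (5.5)–(5.7)]
[claim: Mochizuki2012, status: disputed] for every IUT sentence quoted.
-/

noncomputable section

open Set Metric Function NumberField IsDedekindDomain
open scoped Pointwise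

namespace Summit.ABC.IUTFork.Thm311.Real

open Cor312 Cor312.Setting Cor312Vol Literature.IUT.LogThetaLattice Literature.IUT.LogVolume
open Literature.NumberTheory.NumberFields Literature.NumberTheory.GaloisRepresentations.Ultrametric

/-! ## 1. One factor: (Ind2) is transitive on each `p`-level of `𝔪_v` at a ball place -/

section OneFactor

variable {F : Type} [Field F] [NumberField F] {p : ℕ} [hp : Fact p.Prime]
variable {logv : PadicLogs F} (hlog : LogvAnalyticAt p logv)
variable (v : HeightOneSpectrum (𝓞 F)) (hv : ((p : ℕ) : 𝓞 F) ∈ v.asIdeal)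

include hlog in
/-- **(Ind2) is TRANSITIVE on each `p`-level of `𝔪_v` at a BALL place**: if `log_p(𝒪_v^×) = {‖y‖ ≤ ‖ϖ‖}`, `k ∈ ℤ`, and `t, y` satisfy
`‖p‖·(‖p‖^k·‖ϖ‖) < ‖t‖, ‖y‖ ≤ ‖p‖^k·‖ϖ‖`, some `g ∈ Real.ismDH logv (inr v)` maps `t` to `y` (abc-iut-w5-d236's
`exists_mem_ismDH_apply_eq_of_tame` with its one tame input made the hypothesis). [cite: WeilBNT1967, Ch. II §2, Th. 1]
[cite: DupuyHilado2025, §4.9] -/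
theorem exists_mem_ismDH_apply_eq_of_ball {ϖ : (RescaledCompletion F p v hv)ˣ}
    (hΛ : logUnits (RescaledCompletion F p v hv) =
      closedBall (0 : RescaledCompletion F p v hv) ‖(ϖ : RescaledCompletion F p v hv)‖)
    (k : ℤ) {t y : RescaledCompletion F p v hv}
    (ht1 : ‖(p : ℚ_[p])‖ * (‖(p : ℚ_[p])‖ ^ k * ‖(ϖ : RescaledCompletion F p v hv)‖) < ‖t‖)
    (ht2 : ‖t‖ ≤ ‖(p : ℚ_[p])‖ ^ k * ‖(ϖ : RescaledCompletion F p v hv)‖)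
    (hy1 : ‖(p : ℚ_[p])‖ * (‖(p : ℚ_[p])‖ ^ k * ‖(ϖ : RescaledCompletion F p v hv)‖) < ‖y‖)
    (hy2 : ‖y‖ ≤ ‖(p : ℚ_[p])‖ ^ k * ‖(ϖ : RescaledCompletion F p v hv)‖) :
    ∃ g ∈ ismDH logv (.inr v), toR p v hv (g (ofR p v hv t)) = y := by
  have hlev : ((p : ℚ_[p]) ^ k) • (logUnits (RescaledCompletion F p v hv) : Set (RescaledCompletion F p v hv)) =
      closedBall 0 (‖(p : ℚ_[p])‖ ^ k * ‖(ϖ : RescaledCompletion F p v hv)‖) := by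
    rw [hΛ, zpow_smul_closedBall_eq]
  have hlev' : ((p : ℚ_[p]) * (p : ℚ_[p]) ^ k) • (logUnits (RescaledCompletion F p v hv) : Set (RescaledCompletion F p v hv)) =
      closedBall 0 (‖(p : ℚ_[p])‖ * (‖(p : ℚ_[p])‖ ^ k * ‖(ϖ : RescaledCompletion F p v hv)‖)) := by
    rw [mul_smul, hlev, smul_closedBall' (Nat.cast_ne_zero.mpr hp.out.ne_zero), smul_zero]
  refine exists_mem_ismDH_apply_eq_of_primitive hlog v hv (c := (p : ℚ_[p]) ^ k) ?_ ?_ ?_ ?_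
  · rw [hlev]; exact mem_closedBall_zero_iff.2 ht2
  · rw [hlev']; exact fun h => (mem_closedBall_zero_iff.1 h).not_gt ht1
  · rw [hlev]; exact mem_closedBall_zero_iff.2 hy2
  · rw [hlev']; exact fun h => (mem_closedBall_zero_iff.1 h).not_gt hy1

include hlog in
/-- **Mover to the top of the level at a ball place**: a `t` in the `p`-level `k` of `𝔪_v` is carried by some (Ind2)-element onto an
element of norm EXACTLY `‖p‖^k·‖ϖ‖`. [cite: WeilBNT1967, Ch. II §2, Th. 1] [cite: DupuyHilado2025, §4.9] -/
theorem exists_mem_ismDH_norm_apply_eq_of_ball {ϖ : (RescaledCompletion F p v hv)ˣ}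
    (hΛ : logUnits (RescaledCompletion F p v hv) =
      closedBall (0 : RescaledCompletion F p v hv) ‖(ϖ : RescaledCompletion F p v hv)‖)
    (k : ℤ) {t : RescaledCompletion F p v hv}
    (ht1 : ‖(p : ℚ_[p])‖ * (‖(p : ℚ_[p])‖ ^ k * ‖(ϖ : RescaledCompletion F p v hv)‖) < ‖t‖)
    (ht2 : ‖t‖ ≤ ‖(p : ℚ_[p])‖ ^ k * ‖(ϖ : RescaledCompletion F p v hv)‖) :
    ∃ g ∈ ismDH logv (.inr v),
      ‖toR p v hv (g (ofR p v hv t))‖ = ‖(p : ℚ_[p])‖ ^ k * ‖(ϖ : RescaledCompletion F p v hv)‖ := by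
  have hy : ‖((p : ℚ_[p]) ^ k) • (ϖ : RescaledCompletion F p v hv)‖ =
      ‖(p : ℚ_[p])‖ ^ k * ‖(ϖ : RescaledCompletion F p v hv)‖ := by rw [norm_smul, norm_zpow]
  have hpos : 0 < ‖(p : ℚ_[p])‖ ^ k * ‖(ϖ : RescaledCompletion F p v hv)‖ :=
    mul_pos (zpow_pos (norm_pos_iff.2 (Nat.cast_ne_zero.mpr hp.out.ne_zero)) k) (norm_pos_iff.2 ϖ.ne_zero)
  obtain ⟨g, hg, hgt⟩ := exists_mem_ismDH_apply_eq_of_ball hlog v hv hΛ k ht1 ht2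
    (y := ((p : ℚ_[p]) ^ k) • (ϖ : RescaledCompletion F p v hv))
    (by rw [hy]; exact mul_lt_of_lt_one_left hpos Padic.norm_p_lt_one) hy.le
  exact ⟨g, hg, by rw [hgt, hy]⟩

include hlog in
/-- **The MOVER HYPOTHESIS at a ball place**: if `t` lies in the `p`-level `k` of `𝔪_v` and `‖t_q‖ ≤ ‖p‖^k·‖ϖ‖`, some (Ind2)-element `g`
has `‖t_q‖ ≤ ‖g(t)‖`. [cite: WeilBNT1967, Ch. II §2, Th. 1] [cite: DupuyHilado2025, §4.9] -/
theorem exists_mover_of_ball {ϖ : (RescaledCompletion F p v hv)ˣ}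
    (hΛ : logUnits (RescaledCompletion F p v hv) =
      closedBall (0 : RescaledCompletion F p v hv) ‖(ϖ : RescaledCompletion F p v hv)‖)
    (k : ℤ) {t tq : RescaledCompletion F p v hv}
    (ht1 : ‖(p : ℚ_[p])‖ * (‖(p : ℚ_[p])‖ ^ k * ‖(ϖ : RescaledCompletion F p v hv)‖) < ‖t‖)
    (ht2 : ‖t‖ ≤ ‖(p : ℚ_[p])‖ ^ k * ‖(ϖ : RescaledCompletion F p v hv)‖)
    (htq : ‖tq‖ ≤ ‖(p : ℚ_[p])‖ ^ k * ‖(ϖ : RescaledCompletion F p v hv)‖) :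
    ∃ g ∈ ismDH logv (.inr v), ‖tq‖ ≤ ‖toR p v hv (g (ofR p v hv t))‖ := by
  obtain ⟨g, hg, hgt⟩ := exists_mem_ismDH_norm_apply_eq_of_ball hlog v hv hΛ k ht1 ht2
  exact ⟨g, hg, by rw [hgt]; exact htq⟩

/-! ## 2. The donation of a non-last slot at a ball place: `‖p‖⁻¹·‖ϖ_v‖` -/

include hlog in
/-- **At a ball place the value `1` is moved to norm `‖p‖⁻¹·‖ϖ_v‖ = ‖ϖ_v‖^{1−e_v} ≥ 1`** (`1` lies on the `p`-level `−1` of `𝔪_v`,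
on which (Ind2) is transitive): the CONTENT DONATED by a non-last capsule slot (abc-iut-w5-d180's `exists_mem_ismDH_norm_one_eq_of_tame`,
«tame» ↦ «ball»). [cite: WeilBNT1967, Ch. II §2, Th. 1] [cite: DupuyHilado2025, §4.9] [cite: NeukirchANT1999, Ch. II Prop. (5.5)] -/
theorem exists_mem_ismDH_norm_one_eq_of_ball {ϖ : (RescaledCompletion F p v hv)ˣ} (hϖ : IsUniformizer ϖ)
    (hΛ : logUnits (RescaledCompletion F p v hv) =
      closedBall (0 : RescaledCompletion F p v hv) ‖(ϖ : RescaledCompletion F p v hv)‖) :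
    ∃ g ∈ ismDH logv (.inr v),
      ‖toR p v hv (g (ofR p v hv 1))‖ = ‖(p : ℚ_[p])‖⁻¹ * ‖(ϖ : RescaledCompletion F p v hv)‖ := by
  set K := RescaledCompletion F p v hv
  have hp0 : 0 < ‖(p : ℚ_[p])‖ := norm_pos_iff.2 (Nat.cast_ne_zero.mpr hp.out.ne_zero)
  -- `‖p‖ = ‖ϖ‖^e ≤ ‖ϖ‖`
  have hpϖ : ‖(p : ℚ_[p])‖ ≤ ‖(ϖ : K)‖ := by
    rw [Padic.norm_p, ← norm_pow_absRamificationIdx p K hϖ]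
    calc ‖(ϖ : K)‖ ^ absRamificationIdx p K ≤ ‖(ϖ : K)‖ ^ 1 :=
          pow_le_pow_of_le_one (norm_nonneg _) hϖ.norm_lt_one.le (absRamificationIdx_pos p K)
      _ = ‖(ϖ : K)‖ := pow_one _
  have h1 : ‖(p : ℚ_[p])‖ * (‖(p : ℚ_[p])‖ ^ (-1 : ℤ) * ‖(ϖ : K)‖) < ‖(1 : K)‖ := by
    rw [zpow_neg_one, ← mul_assoc, mul_inv_cancel₀ hp0.ne', one_mul, norm_one]
    exact hϖ.norm_lt_one
  have h2 : ‖(1 : K)‖ ≤ ‖(p : ℚ_[p])‖ ^ (-1 : ℤ) * ‖(ϖ : K)‖ := by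
    rw [norm_one, zpow_neg_one]
    calc (1 : ℝ) = ‖(p : ℚ_[p])‖⁻¹ * ‖(p : ℚ_[p])‖ := (inv_mul_cancel₀ hp0.ne').symm
      _ ≤ ‖(p : ℚ_[p])‖⁻¹ * ‖(ϖ : K)‖ := mul_le_mul_of_nonneg_left hpϖ (inv_nonneg.2 hp0.le)
  obtain ⟨g, hg, hgn⟩ := exists_mem_ismDH_norm_apply_eq_of_ball hlog v hv hΛ (-1) h1 h2
  exact ⟨g, hg, by rw [hgn, zpow_neg_one]⟩

end OneFactor

/-! ## 3. The sharp real setting: the inclusion at `(j, p)` from ball places -/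

variable {F : Type} [Field F] [NumberField F] (X : PilotData F) {logv : PadicLogs F} (hlog : LogvAnalytic logv)
  (M : Type) [Field M] [NumberField M]
  (archPk : ∀ (j : (thetaIndex X).Label) (vQ : (thetaIndex X).VQ), Set ((logShellsDH X logv).Packet j vQ))
  (archSub : ∀ (j : (thetaIndex X).Label) (v : (thetaIndex X).V),
    Set ((logShellsDH X logv).Packet j ((thetaIndex X).over v)))
  (Ψ : ℤ → ∀ v : (thetaIndex X).V, v ∈ (thetaIndex X).Vbad → Set ((logShellsDH X logv).StarPacket v))
  (act : ℤ → ∀ v : (thetaIndex X).V, v ∈ (thetaIndex X).Vbad →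
    (logShellsDH X logv).StarPacket v → Module.End ℚ ((logShellsDH X logv).StarPacket v))
  (Mmod : ℤ → ∀ j : (thetaIndex X).LabelStar, Set ((logShellsDH X logv).GlobalPacket j.1))
  (region : ℤ → ∀ j : (thetaIndex X).LabelStar, FinDivisor M → ∀ vQ : (thetaIndex X).VQ,
    Set ((logShellsDH X logv).Packet j.1 vQ))
  (n : ℤ) {HT : Type} {LogLink : HT → HT → Type} {IsFull : ∀ {s t : HT}, LogLink s t → Prop}
  (lat : LGPGaussianLogThetaLattice LogLink IsFull)
  {Frd : Type} {IsoF : Frd → Frd → Type} {Ob : Frd → Type} {realify : Frd → Frd} {Strip : Type}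
  {IsoS : Strip → Strip → Type} {Mv : ∀ v : (thetaIndex X).V, v ∈ (thetaIndex X).Vbad → Type}
  [∀ v h, Monoid (Mv v h)]
  (sig : GlobalLGPFrobenioidSignature (thetaIndex X).lstar (thetaIndex X).V (· ∈ (thetaIndex X).Vbad)
    Frd IsoF Ob realify Strip IsoS Mv)
  (split : SplittingMonoids Mv) {ObΔ : Type} {N : ∀ v : (thetaIndex X).V, v ∈ (thetaIndex X).Vbad → Type}
  [∀ v h, Monoid (N v h)] (qData : QPilotData ObΔ N)
  (tq : ∀ (pp : Nat.Primes) (x : (thetaIndex X).Fibre (.inr pp)), haveI : Fact (pp : ℕ).Prime := ⟨pp.2⟩; kOf X pp.1 x)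
  (t : ∀ (pp : Nat.Primes) (_ : Fin X.lstar) (x : (thetaIndex X).Fibre (.inr pp)),
    haveI : Fact (pp : ℕ).Prime := ⟨pp.2⟩; kOf X pp.1 x)
  (htq0 : ∀ pp x, tq pp x ≠ 0)
  (htq1 : ∀ (pp : Nat.Primes) (x : (thetaIndex X).Fibre (.inr pp)),
    haveI : Fact (pp : ℕ).Prime := ⟨pp.2⟩; placeOf X pp.1 x ∉ X.S → ‖tq pp x‖ = 1)

/-- At a ball fibre point `x | p` (through the presentation's `φ_x = id`) some `g ∈ Real.ismDH logv x` has `‖p‖⁻¹·‖ϖ_x‖ ≤ ‖g 1‖`.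
[cite: WeilBNT1967, Ch. II §2, Th. 1] [cite: DupuyHilado2025, §4.9] -/
theorem exists_mem_ismDH_norm_one_ge_of_ball (pp : Nat.Primes) (x : (thetaIndex X).Fibre (.inr pp)) {ρ : ℝ}
    (h : haveI : Fact (pp : ℕ).Prime := ⟨pp.2⟩
      ∃ ϖ : (kOf X pp.1 x)ˣ, IsUniformizer ϖ ∧ logUnits (kOf X pp.1 x) = closedBall (0 : kOf X pp.1 x) ‖(ϖ : kOf X pp.1 x)‖ ∧
        ρ ≤ ‖(pp : ℚ_[pp])‖⁻¹ * ‖(ϖ : kOf X pp.1 x)‖) :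
    haveI : Fact (pp : ℕ).Prime := ⟨pp.2⟩
    ∃ g ∈ ismDH logv x.1, ρ ≤ ‖(presAt X hlog pp).φ x (g (((presAt X hlog pp).φ x).symm 1))‖ := by
  haveI : Fact (pp : ℕ).Prime := ⟨pp.2⟩
  obtain ⟨ϖ, hϖ, hΛ, hρ⟩ := h
  obtain ⟨x1, hx⟩ := x
  rcases x1 with w | v
  · exact absurd hx (by simp [thetaIndex])
  · obtain ⟨g, hg, hgn⟩ :=
      exists_mem_ismDH_norm_one_eq_of_ball (hlog pp) v (natCast_mem_placeOf X pp.1 ⟨.inr v, hx⟩) hϖ hΛ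
    exact ⟨g, hg, hρ.trans (le_of_eq hgn.symm)⟩

/-- At a ball fibre point the last-slot value `t_{Θ,j,x}` on the `p`-level `k` is moved to norm `‖p‖^k·‖ϖ_x‖` (the top of its level).
[cite: WeilBNT1967, Ch. II §2, Th. 1] [cite: DupuyHilado2025, §4.9] -/
theorem exists_mem_ismDH_norm_labelIdele_ge_of_ball (pp : Nat.Primes) (j : (thetaIndex X).Label)
    (x : (thetaIndex X).Fibre (.inr pp)) (k : ℤ) {Nw : ℝ}
    (h : haveI : Fact (pp : ℕ).Prime := ⟨pp.2⟩
      ∃ ϖ : (kOf X pp.1 x)ˣ, logUnits (kOf X pp.1 x) = closedBall (0 : kOf X pp.1 x) ‖(ϖ : kOf X pp.1 x)‖ ∧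
        ‖(pp : ℚ_[pp])‖ * (‖(pp : ℚ_[pp])‖ ^ k * ‖(ϖ : kOf X pp.1 x)‖) < ‖labelIdele X t pp j x‖ ∧
        ‖labelIdele X t pp j x‖ ≤ ‖(pp : ℚ_[pp])‖ ^ k * ‖(ϖ : kOf X pp.1 x)‖ ∧
        Nw = ‖(pp : ℚ_[pp])‖ ^ k * ‖(ϖ : kOf X pp.1 x)‖) :
    haveI : Fact (pp : ℕ).Prime := ⟨pp.2⟩
    ∃ g ∈ ismDH logv x.1, Nw ≤ ‖(presAt X hlog pp).φ x (g (((presAt X hlog pp).φ x).symm (labelIdele X t pp j x)))‖ := by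
  haveI : Fact (pp : ℕ).Prime := ⟨pp.2⟩
  obtain ⟨ϖ, hΛ, h1, h2, rfl⟩ := h
  obtain ⟨x1, hx⟩ := x
  rcases x1 with w | v
  · exact absurd hx (by simp [thetaIndex])
  · obtain ⟨g, hg, hgn⟩ := exists_mem_ismDH_norm_apply_eq_of_ball (hlog pp) v (natCast_mem_placeOf X pp.1 ⟨.inr v, hx⟩) hΛ
      k h1 h2
    exact ⟨g, hg, le_of_eq hgn.symm⟩

/-- **q-REGION ⊆ Θ-HULL AT `(i+1, p)` IN THE BALL MULTI-SLOT REGIME** (abc-iut-w5-d180's `…_of_tame_slots`, «tame» ↦ «ball»). Data at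
the prime `p`: a DONATION RATE `ρ ≥ 1` with, at EVERY place `x | p`, a uniformizer `ϖ_x` with `log_p(𝒪_x^×) = {‖y‖ ≤ ‖ϖ_x‖}` and
`ρ ≤ ‖p‖⁻¹·‖ϖ_x‖`; and at every `w | p` EITHER `‖t_{q,w}‖ ≤ ‖t_{Θ,i+1,w}‖` OR `log_p(𝒪_w^×)` is the ball `{‖y‖ ≤ ‖ϖ‖}` and `t_{Θ,i+1,w}`
lies on a `p`-level `k` of it with `‖t_{q,w}‖ ≤ ρ^{i+1}·‖p‖^k·‖ϖ‖`. Then the q-pilot region at `(i+1, p)` lies in `ⁿ˚𝒰_{i+1,p}`.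
[cite: DupuyHilado2025, §3.9, §4.9] [cite: WeilBNT1967, Ch. II §2, Th. 1] [claim: Mochizuki2012, status: disputed] -/
theorem qRegion_subset_thetaHull_settingDHVolSharp_of_ball_slots (i : Fin (thetaIndex X).lstar) (pp : Nat.Primes) (ρ : ℝ)
    (hρ1 : 1 ≤ ρ)
    (hρ : haveI : Fact (pp : ℕ).Prime := ⟨pp.2⟩
      ∀ x : (thetaIndex X).Fibre (.inr pp),
        ∃ ϖ : (kOf X pp.1 x)ˣ, IsUniformizer ϖ ∧
          logUnits (kOf X pp.1 x) = closedBall (0 : kOf X pp.1 x) ‖(ϖ : kOf X pp.1 x)‖ ∧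
          ρ ≤ ‖(pp : ℚ_[pp])‖⁻¹ * ‖(ϖ : kOf X pp.1 x)‖)
    (hwin : haveI : Fact (pp : ℕ).Prime := ⟨pp.2⟩
      ∀ w : (thetaIndex X).Fibre (.inr pp),
        ‖tq pp w‖ ≤ ‖t pp i w‖ ∨
          ∃ (ϖ : (kOf X pp.1 w)ˣ) (k : ℤ),
            logUnits (kOf X pp.1 w) = closedBall (0 : kOf X pp.1 w) ‖(ϖ : kOf X pp.1 w)‖ ∧
            ‖(pp : ℚ_[pp])‖ * (‖(pp : ℚ_[pp])‖ ^ k * ‖(ϖ : kOf X pp.1 w)‖) < ‖t pp i w‖ ∧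
            ‖t pp i w‖ ≤ ‖(pp : ℚ_[pp])‖ ^ k * ‖(ϖ : kOf X pp.1 w)‖ ∧
            ‖tq pp w‖ ≤ ρ ^ ((i : ℕ) + 1) * (‖(pp : ℚ_[pp])‖ ^ k * ‖(ϖ : kOf X pp.1 w)‖)) :
    (settingDHVolSharp X hlog M archPk archSub Ψ act Mmod region n lat sig split qData tq t htq0 htq1).qRegion
        (labelSucc i) (.inr pp) ⊆
      (settingDHVolSharp X hlog M archPk archSub Ψ act Mmod region n lat sig split qData tq t htq0 htq1).thetaHull
        (labelSucc i) (.inr pp) := by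
  haveI : Fact (pp : ℕ).Prime := ⟨pp.2⟩
  have hρ0 : 0 ≤ ρ := zero_le_one.trans hρ1
  -- per place: a last-slot target `N_w ≥ 0`, reached by a mover, with `‖t_{q,w}‖ ≤ ρ^{i+1}·N_w`
  have key : ∀ w : (thetaIndex X).Fibre (.inr pp), ∃ Nw : ℝ, 0 ≤ Nw ∧
      (∃ g ∈ ismDH logv w.1,
        Nw ≤ ‖(presAt X hlog pp).φ w (g (((presAt X hlog pp).φ w).symm (labelIdele X t pp (labelSucc i) w)))‖) ∧
      ‖tq pp w‖ ≤ ρ ^ ((i : ℕ) + 1) * Nw := by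
    intro w
    rcases hwin w with h | ⟨ϖ, k, hΛ, h1, h2, h3⟩
    · refine ⟨‖t pp i w‖, norm_nonneg _, ⟨LinearEquiv.refl ℚ _, refl_mem_ismDH logv w.1, ?_⟩, ?_⟩
      · rw [labelIdele_labelSucc]
        simp only [LinearEquiv.refl_apply, LinearEquiv.apply_symm_apply]
        exact le_of_eq rfl
      · exact h.trans (le_mul_of_one_le_left (norm_nonneg _) (one_le_pow₀ hρ1))
    · refine ⟨‖(pp : ℚ_[pp])‖ ^ k * ‖(ϖ : kOf X pp.1 w)‖,
        mul_nonneg (zpow_nonneg (norm_nonneg _) _) (norm_nonneg _), ?_, h3⟩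
      exact exists_mem_ismDH_norm_labelIdele_ge_of_ball X hlog t pp (labelSucc i) w k
        ⟨ϖ, hΛ, by rw [labelIdele_labelSucc]; exact h1, by rw [labelIdele_labelSucc]; exact h2, rfl⟩
  choose Nf hN0 hN hle using key
  refine qRegion_subset_thetaHull_settingDHVolSharp_of_targets X hlog M archPk archSub Ψ act Mmod region n lat sig split qData
    tq t htq0 htq1 (labelSucc i) pp (fun _ => ρ) Nf (fun _ => hρ0) hN0 (fun x => ?_) hN fun e => ?_
  · obtain ⟨ϖ, hϖ, hΛ, hρle⟩ := hρ x
    exact exists_mem_ismDH_norm_one_ge_of_ball X hlog pp x ⟨ϖ, hϖ, hΛ, hρle⟩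
  · rw [Fin.prod_const]
    exact hle _

/-- **THE BALL MULTI-SLOT WINDOW IN ORDERS** at the packet `(i+1, p)`, `j = i+1` (abc-iut-w5-d180's `…_of_tame_orders`, «tame» ↦
«ball»): every place `x` over `p` has the SAME ramification index `e` and a uniformizer `ϖ_x` with `log_p(𝒪_x^×) = {‖y‖ ≤ ‖ϖ_x‖}`; at
every `w | p` either `‖t_{q,w}‖ ≤ ‖t_{Θ,j,w}‖` or `‖t_{Θ,j,w}‖ = ‖ϖ_w‖^{m_Θ}`, `‖t_{q,w}‖ = ‖ϖ_w‖^{m_q}` with `m_Θ ≥ 1` and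
**`e·⌊(m_Θ−1)/e⌋ + 1 − j·(e−1) ≤ m_q`**: THEN the q-pilot region at `(j, p)` lies in `ⁿ˚𝒰_{j,p}` (the last slot reaches the top of the
`p`-level of `t_Θ`, the `j` non-last slots donate `e − 1` orders each). Any prime `p`; no tameness hypothesis beyond the ball.
[cite: DupuyHilado2025, §3.9, §4.9] [cite: WeilBNT1967, Ch. II §2, Th. 1] [claim: Mochizuki2012, status: disputed] -/
theorem qRegion_subset_thetaHull_settingDHVolSharp_of_ball_orders (i : Fin (thetaIndex X).lstar) (pp : Nat.Primes) (e : ℕ)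
    (ϖ : haveI : Fact (pp : ℕ).Prime := ⟨pp.2⟩; ∀ x : (thetaIndex X).Fibre (.inr pp), (kOf X pp.1 x)ˣ)
    (hfib : haveI : Fact (pp : ℕ).Prime := ⟨pp.2⟩
      ∀ x : (thetaIndex X).Fibre (.inr pp), (placeOf X pp.1 x).asIdeal.ramificationIdx ℤ = e ∧ IsUniformizer (ϖ x) ∧
        logUnits (kOf X pp.1 x) = closedBall (0 : kOf X pp.1 x) ‖(ϖ x : kOf X pp.1 x)‖)
    (hord : haveI : Fact (pp : ℕ).Prime := ⟨pp.2⟩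
      ∀ w : (thetaIndex X).Fibre (.inr pp),
        ‖tq pp w‖ ≤ ‖t pp i w‖ ∨
          ∃ mΘ mq : ℤ, ‖t pp i w‖ = ‖(ϖ w : kOf X pp.1 w)‖ ^ mΘ ∧ ‖tq pp w‖ = ‖(ϖ w : kOf X pp.1 w)‖ ^ mq ∧ 1 ≤ mΘ ∧
            (e : ℤ) * ((mΘ - 1) / e) + 1 - ((i : ℕ) + 1 : ℕ) * ((e : ℤ) - 1) ≤ mq) :
    (settingDHVolSharp X hlog M archPk archSub Ψ act Mmod region n lat sig split qData tq t htq0 htq1).qRegion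
        (labelSucc i) (.inr pp) ⊆
      (settingDHVolSharp X hlog M archPk archSub Ψ act Mmod region n lat sig split qData tq t htq0 htq1).thetaHull
        (labelSucc i) (.inr pp) := by
  haveI hF : Fact (pp : ℕ).Prime := ⟨pp.2⟩
  have hp1 : (1 : ℝ) ≤ (pp : ℕ) := by exact_mod_cast pp.2.one_lt.le
  have hp0 : (0 : ℝ) < (pp : ℕ) := by positivity
  -- the invariants at a place over `p`: `e_K = e`, `‖ϖ_x‖ = p^{-1/e}`, `‖ϖ_x‖^e = p⁻¹`
  have heK : ∀ x : (thetaIndex X).Fibre (.inr pp), absRamificationIdx (pp : ℕ) (kOf X pp.1 x) = e := fun x =>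
    (absRamificationIdx_rescaledCompletion F (pp : ℕ) (placeOf X pp.1 x) (natCast_mem_placeOf X pp.1 x)).trans (hfib x).1
  have he0 : 0 < e := by
    rw [← heK (Classical.arbitrary _)]
    exact absRamificationIdx_pos _ _
  -- donation rate `ρ = p · p^{-1/e}`
  set ρ : ℝ := ((pp : ℕ) : ℝ) * ((pp : ℕ) : ℝ) ^ (-(1 / (e : ℝ))) with hρ
  have hnormϖ : ∀ x : (thetaIndex X).Fibre (.inr pp), ‖(ϖ x : kOf X pp.1 x)‖ = ((pp : ℕ) : ℝ) ^ (-(1 / (e : ℝ))) := by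
    intro x
    rw [norm_eq_rpow_of_isUniformizer (pp : ℕ) (kOf X pp.1 x) (hfib x).2.1, heK x]
  have hρ1 : 1 ≤ ρ := by
    have h : ((pp : ℕ) : ℝ) ^ (-(1 : ℝ)) ≤ ((pp : ℕ) : ℝ) ^ (-(1 / (e : ℝ))) := by
      refine Real.rpow_le_rpow_of_exponent_le hp1 (neg_le_neg ?_)
      rw [div_le_one (by exact_mod_cast he0)]
      exact_mod_cast he0
    calc (1 : ℝ) = ((pp : ℕ) : ℝ) * ((pp : ℕ) : ℝ) ^ (-(1 : ℝ)) := by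
          rw [Real.rpow_neg_one, mul_inv_cancel₀ hp0.ne']
      _ ≤ ρ := mul_le_mul_of_nonneg_left h hp0.le
  refine qRegion_subset_thetaHull_settingDHVolSharp_of_ball_slots X hlog M archPk archSub Ψ act Mmod region n lat sig split qData
    tq t htq0 htq1 i pp ρ hρ1 (fun x => ⟨ϖ x, (hfib x).2.1, (hfib x).2.2, le_of_eq ?_⟩) fun w => ?_
  · -- `ρ = ‖p‖⁻¹ · ‖ϖ_x‖`
    rw [hnormϖ x, Padic.norm_p, inv_inv]
  · rcases hord w with h | ⟨mΘ, mq, hΘ, hq, h1, hle⟩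
    · exact Or.inl h
    · right
      set a : ℝ := ‖(ϖ w : kOf X pp.1 w)‖ with ha
      have ha0 : 0 < a := norm_pos_iff.2 (ϖ w).ne_zero
      have ha1 : a < 1 := (hfib w).2.1.norm_lt_one
      have hae : a ^ e = ((pp : ℕ) : ℝ)⁻¹ := by rw [ha, ← heK w]; exact norm_pow_absRamificationIdx (pp : ℕ) _ (hfib w).2.1
      have hpnorm : ‖((pp : ℕ) : ℚ_[pp])‖ = a ^ (e : ℤ) := by rw [Padic.norm_p, zpow_natCast, hae]
      have hρa : ρ = a ^ (1 - (e : ℤ)) := by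
        rw [zpow_sub₀ ha0.ne', zpow_one, zpow_natCast, hae, div_inv_eq_mul, hρ, ← hnormϖ w, ← ha, mul_comm]
      -- the `p`-level of `t_Θ`: `k = ⌊(m_Θ − 1)/e⌋`
      set k : ℤ := (mΘ - 1) / e with hk
      have hediv : (e : ℤ) * k ≤ mΘ - 1 := Int.mul_ediv_self_le (by exact_mod_cast he0.ne')
      have hemod : mΘ - 1 < (e : ℤ) * k + e := Int.lt_mul_ediv_self_add (by exact_mod_cast he0)
      have hzle : ∀ A B : ℤ, a ^ A ≤ a ^ B ↔ B ≤ A := fun A B => zpow_le_zpow_iff_right_of_lt_one₀ ha0 ha1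
      have hzlt : ∀ A B : ℤ, a ^ A < a ^ B ↔ B < A := fun A B => zpow_lt_zpow_iff_right_of_lt_one₀ ha0 ha1
      refine ⟨ϖ w, k, (hfib w).2.2, ?_, ?_, ?_⟩
      · -- `‖p‖·(‖p‖^k·‖ϖ‖) < ‖t_Θ‖`
        rw [hΘ, hpnorm, ← zpow_mul, ← ha, ← zpow_add_one₀ ha0.ne', ← zpow_add₀ ha0.ne', hzlt]
        linarith
      · -- `‖t_Θ‖ ≤ ‖p‖^k·‖ϖ‖`
        rw [hΘ, hpnorm, ← zpow_mul, ← ha, ← zpow_add_one₀ ha0.ne', hzle]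
        linarith
      · -- `‖t_q‖ ≤ ρ^{i+1}·(‖p‖^k·‖ϖ‖)`
        rw [hq, hpnorm, hρa, ← zpow_mul, ← ha, ← zpow_add_one₀ ha0.ne', ← zpow_natCast, ← zpow_mul,
          ← zpow_add₀ ha0.ne', hzle]
        push_cast at hle ⊢
        linarith

end Summit.ABC.IUTFork.Thm311.Real

end
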